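import Summits.Ventures.LatticeQCDFlow.Scaling.DoeblinHotGapAndMixing
import Summits.Ventures.LatticeQCDFlow.Scaling.DominatedStarAutocorrelationCeiling

/-!
HONEST FRAMING: exact (Metropolis-corrected) sampling algorithms for lattice gauge theory; figures
of merit are autocorrelation/cost numbers at stated couplings and volumes; no continuum-physics
claim.

# DoeblinHotSeparation — WITH A DOEBLIN-MINORISED HOT SAMPLER THE MAP-ASSISTED HUB STILL SATISFIES THE WHOLE-SPACE
# DOEBLIN CONDITION `Pⁿ(x,·) ≥ (1 − ((2K+p)/p)(1−tcp/(2m))ⁿ)·π̃`, SO `s(n) ≤ ((2K+p)/p)(1−tcp/(2m))ⁿ`, THE SCHEME IS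
# IRREDUCIBLE, AND `τ_int(g) ≤ 2m/(tcp) − ½` FOR EVERY OBSERVABLE `g` — ONCE `4t ≤ p(1−t)·a·w_0` (lean-2 GEN-27, ours)

Venture-side (OURS).  Cell `lqcd-flow` (pub-lqcd), unit `pub-lqcd-lean-2-g27`, 2026-08-27.  Doeblin-minorised hot
samplers, file 7.  Settings of `Scaling/DoeblinHotMixingCeiling` (the scheme `t·GSw + (1−t)·(w_E·Ẽ_0 + Π_w^M)` with
a partly refreshed hub) and `Scaling/DoeblinHotSampler` (chapter M's scheme `t·GSw + (1−t)·Π_w^M` whose hot kernel is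
only `μ_0`-stationary with `M_0(u,·) ≥ a·μ_0(·)`).  One-sided domination `p·μ_{l_r}(φ_r u) ≤ μ_0(u)`, `0 < p ≤ 1`,
hub multiplicities `≥ c`, `1 ≤ c ≤ m`.

## What is proved

* §1 **`refreshStar_kernelAt_ge`** — `Pⁿ(x,z) ≥ (1 − ((2K+p)/p)(1 − tcp/(2m))ⁿ)·π̃(z)` for the partly refreshed hub
  (`4t ≤ p(1−t)w_E`); **`doeblinStar_kernelAt_ge`** — the same for the Doeblin-minorised hot sampler
  (`4t ≤ p(1−t)·a·w_0`); **`doeblinStar_sepDist_le`**, **`doeblinStar_sepDist_le_of_ge_log`** (`s(n) ≤ ε` once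
  `n ≥ (2m/(tcp))·log((2K+p)/(pε))`).
* §2 reversible single-site kernels: **`doeblinStar_isIrreducible`**; **`doeblinStar_asympVar_le`**
  (`v(g) ≤ (2/(tcp/(2m)) − 1)·Var_π̃(g)`); **`doeblinStar_tauInt_le`** (`τ_int(g) ≤ 1/(tcp/(2m)) − ½` for EVERY `g`,
  `|S| ≥ 2`).

Reading (no numerics implied): the honest effective-sample-size statement of chapter M — every observable's
integrated autocorrelation time is at most `2m/(tcp) − ½` — holds verbatim for a Metropolised-flow hot level with
acceptance floor `a`, provided the swap fraction respects `4t ≤ p(1−t)·a·w_0`.  NOT CLAIMED: anything without the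
minorisation; anything measured.  Literature grade (cell rule): OWN RESULT; Levin–Peres–Wilmer Lemma 6.16 ∕ the
variance bound behind `tauInt_le_of_absSpectralGap_ge` are the tree's typed statements used as lemmas; nothing new
cited; no new bib keys.
-/

noncomputable section

open Finset Function
open Literature.Probability.MarkovChains

namespace Summit.Ventures.LatticeQCDFlow.Scaling

variable {S : Type*} [Fintype S] [DecidableEq S] {K m : ℕ} {μ : Fin (K + 1) → S → ℝ} {M E : Fin (K + 1) → S → S → ℝ}
  {w : Fin (K + 1) → ℝ} {t wE p a : ℝ}

section Sep
variable (κ : Fin m → Fin K) (φ : Fin m → Equiv.Perm S)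

/-! ## §1 The whole-space Doeblin condition and the separation distance -/

/-- **`Pⁿ(x,z) ≥ (1 − ((2K+p)/p)·(1 − tcp/(2m))ⁿ)·π̃(z)` FOR THE PARTLY REFRESHED HUB** (one-sided domination,
`4t ≤ p(1−t)w_E`, exact refresh of weight `w_E`, `μ_k`-stationary moves at every level). [ours] -/
theorem refreshStar_kernelAt_ge (hm : 1 ≤ m) (ht0 : 0 ≤ t) (ht1 : t ≤ 1) (hwE0 : 0 ≤ wE) (hw0 : ∀ k, 0 ≤ w k)
    (hw1 : wE + ∑ k, w k = 1) (hμ : ∀ k x, 0 < μ k x) (hμ1 : ∀ k, ∑ u, μ k u = 1) (hM : ∀ k, IsRowStochastic (M k))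
    (hE : ∀ k u v, E k u v = μ k v) (hstat : ∀ (k : Fin (K + 1)) (v : S), ∑ u, μ k u * M k u v = μ k v)
    (hp0 : 0 < p) (hp1 : p ≤ 1) (hdom : ∀ r u, p * μ (κ r).succ (φ r u) ≤ μ 0 u) (hreg : 4 * t ≤ p * (1 - t) * wE)
    {c : ℕ} (hc1 : 1 ≤ c) (hc : ∀ p' : Fin K, c ≤ (univ.filter (fun r : Fin m => κ r = p')).card) (hcm : c ≤ m)
    (n : ℕ) (x z : Fin (K + 1) → S) :
    (1 - (2 * (K : ℝ) + p) / p * (1 - t * c * p / (2 * m)) ^ n) * tensorFun μ z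
      ≤ kernelAt (fun y z : Fin (K + 1) → S =>
          t * ptGraphSwap μ (fun r : Fin m => (((0 : Fin (K + 1)), (κ r).succ) : Fin (K + 1) × Fin (K + 1))) φ y z
          + (1 - t) * (wE * coordKernel E 0 y z + prodKernel w M y z)) n x z := by
  -- the hypothesis-equation objects (reverse constant `q = 0`)
  set α : Fin m → (Fin (K + 1) → S) → ℝ :=
    fun r z => min 1 (tensorFun μ (edgeFlowSwap (φ r) 0 (κ r).succ z) / tensorFun μ z) with hα_def
  have hα : ∀ r z, α r z = min 1 (tensorFun μ (edgeFlowSwap (φ r) 0 (κ r).succ z) / tensorFun μ z) := fun _ _ => rfl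
  set β : Fin m → (Fin (K + 1) → S) → ℝ := fun r z => p * μ (κ r).succ (φ r (z 0)) / μ 0 (z 0) with hβ_def
  have hβ : ∀ r z, β r z = p * μ (κ r).succ (φ r (z 0)) / μ 0 (z 0) := fun _ _ => rfl
  set β' : Fin m → (Fin (K + 1) → S) → ℝ :=
    fun r z => (0 : ℝ) * μ 0 ((φ r).symm (z (κ r).succ)) / μ (κ r).succ (z (κ r).succ) with hβ'_def
  have hβ' : ∀ r z, β' r z = (0 : ℝ) * μ 0 ((φ r).symm (z (κ r).succ)) / μ (κ r).succ (z (κ r).succ) :=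
    fun _ _ => rfl
  set γ : Fin m → (Fin (K + 1) → S) × Finset (Fin (K + 1)) → ℝ := fun r a =>
    if (0 : Fin (K + 1)) ∉ a.2 then (if (κ r).succ ∉ a.2 then α r a.1 else β r a.1)
    else (if (κ r).succ ∉ a.2 then β' r a.1 else 0) with hγ_def
  have hγ : ∀ r a, γ r a = if (0 : Fin (K + 1)) ∉ a.2 then (if (κ r).succ ∉ a.2 then α r a.1 else β r a.1)
      else (if (κ r).succ ∉ a.2 then β' r a.1 else 0) := fun _ _ => rfl
  set gbar : Fin m → Finset (Fin (K + 1)) → ℝ := fun r D =>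
    if (0 : Fin (K + 1)) ∉ D then (if (κ r).succ ∉ D then (1 : ℝ) else p) else (if (κ r).succ ∉ D then (0 : ℝ) else 0)
    with hg_def
  have hg : ∀ r D, gbar r D = if (0 : Fin (K + 1)) ∉ D then (if (κ r).succ ∉ D then (1 : ℝ) else p)
      else (if (κ r).succ ∉ D then (0 : ℝ) else 0) := fun _ _ => rfl
  set Bset : Fin m → Finset (Fin (K + 1)) → Finset (Fin (K + 1)) := fun r D =>
    if (0 : Fin (K + 1)) ∉ D ∧ (κ r).succ ∉ D then D else insert (0 : Fin (K + 1)) (insert (κ r).succ D) with hB_def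
  have hB : ∀ r D, Bset r D = if (0 : Fin (K + 1)) ∉ D ∧ (κ r).succ ∉ D then D
      else insert (0 : Fin (K + 1)) (insert (κ r).succ D) := fun _ _ => rfl
  set Ph : (Fin (K + 1) → S) × Finset (Fin (K + 1)) → (Fin (K + 1) → S) × Finset (Fin (K + 1)) → ℝ := fun a b =>
    ∑ r : Fin m, t / m *
        (γ r a * (if b.1 = edgeFlowSwap (φ r) 0 (κ r).succ a.1 ∧ b.2 = a.2.image (Equiv.swap (0 : Fin (K + 1)) (κ r).succ)
            then (1 : ℝ) else 0)
          + (α r a.1 - γ r a) * (if b.1 = edgeFlowSwap (φ r) 0 (κ r).succ a.1 ∧ b.2 = Bset r a.2 then (1 : ℝ) else 0)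
          + (1 - α r a.1) * (if b.1 = a.1 ∧ b.2 = Bset r a.2 then (1 : ℝ) else 0))
      + (1 - t) * (wE * (coordKernel E 0 a.1 b.1 * (if b.2 = a.2.erase 0 then (1 : ℝ) else 0))
          + ∑ k : Fin (K + 1), w k * (coordKernel M k a.1 b.1 * (if b.2 = a.2 then (1 : ℝ) else 0))) with hPh_def
  have hPh : ∀ a b, Ph a b = ∑ r : Fin m, t / m *
        (γ r a * (if b.1 = edgeFlowSwap (φ r) 0 (κ r).succ a.1 ∧ b.2 = a.2.image (Equiv.swap (0 : Fin (K + 1)) (κ r).succ)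
            then (1 : ℝ) else 0)
          + (α r a.1 - γ r a) * (if b.1 = edgeFlowSwap (φ r) 0 (κ r).succ a.1 ∧ b.2 = Bset r a.2 then (1 : ℝ) else 0)
          + (1 - α r a.1) * (if b.1 = a.1 ∧ b.2 = Bset r a.2 then (1 : ℝ) else 0))
      + (1 - t) * (wE * (coordKernel E 0 a.1 b.1 * (if b.2 = a.2.erase 0 then (1 : ℝ) else 0))
          + ∑ k : Fin (K + 1), w k * (coordKernel M k a.1 b.1 * (if b.2 = a.2 then (1 : ℝ) else 0))) := fun _ _ => rfl
  set Q : Finset (Fin (K + 1)) → Finset (Fin (K + 1)) → ℝ := fun D D' => ∑ r : Fin m, t / m *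
        (gbar r D * (if D' = D.image (Equiv.swap (0 : Fin (K + 1)) (κ r).succ) then (1 : ℝ) else 0)
          + (1 - gbar r D) * (if D' = Bset r D then (1 : ℝ) else 0))
      + (1 - t) * (wE * (if D' = D.erase 0 then (1 : ℝ) else 0) + (1 - wE) * (if D' = D then (1 : ℝ) else 0)) with hQ_def
  have hQ : ∀ D D', Q D D' = ∑ r : Fin m, t / m *
        (gbar r D * (if D' = D.image (Equiv.swap (0 : Fin (K + 1)) (κ r).succ) then (1 : ℝ) else 0)
          + (1 - gbar r D) * (if D' = Bset r D then (1 : ℝ) else 0))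
      + (1 - t) * (wE * (if D' = D.erase 0 then (1 : ℝ) else 0) + (1 - wE) * (if D' = D then (1 : ℝ) else 0)) :=
    fun _ _ => rfl
  have hwE1 : wE ≤ 1 := by
    have h := sum_nonneg fun k (_ : k ∈ (univ : Finset (Fin (K + 1)))) => hw0 k
    linarith
  have hrev : ∀ r u, (0 : ℝ) * μ 0 u ≤ μ (κ r).succ (φ r u) := fun r u => by rw [zero_mul]; exact (hμ _ _).le
  -- the tag estimate and the mass identity `(δ_{univ}Qⁿ)(∅) = 1 − Σ_{D ≠ ∅}`
  have htag := regen_nonempty_le_oneSided κ hm ht0 ht1 hwE0 hwE1 hp0 hp1 le_rfl zero_le_one hreg hg hB hQ hc1 hc hcm n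
  have hQst := regen_isRowStochastic κ hm ht0 ht1 hwE0 hwE1 hp0.le hp1 le_rfl zero_le_one hg hQ
  have hmassQ : ∑ D, lawAt Q (Pi.single (univ : Finset (Fin (K + 1))) 1) n D = 1 := by
    rw [sum_lawAt hQst, Finset.sum_pi_single', if_pos (mem_univ _)]
  have hsplit := Finset.sum_filter_add_sum_filter_not univ (fun D : Finset (Fin (K + 1)) => D ≠ ∅)
    (fun D => lawAt Q (Pi.single (univ : Finset (Fin (K + 1))) 1) n D)
  have hEmp : univ.filter (fun D : Finset (Fin (K + 1)) => ¬D ≠ ∅) = {∅} := by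
    ext D; simp only [Finset.mem_filter, Finset.mem_univ, true_and, not_not, Finset.mem_singleton]
  rw [hmassQ, hEmp, Finset.sum_singleton] at hsplit
  have hmin := dob_minorization_of κ φ hm ht0 ht1 hwE0 hw0 hw1 hμ hμ1 hM hE hstat hp0.le le_rfl hdom hrev hα hβ hβ' hγ hg
    hB hPh hQ (Λ₀ := (Pi.single (x, (univ : Finset (Fin (K + 1)))) (1 : ℝ) : _ → ℝ)) (pointAug_fresh x) (fun a => by
      by_cases ha : a = (x, (univ : Finset (Fin (K + 1))))
      · subst ha; rw [Pi.single_eq_same]; norm_num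
      · rw [Pi.single_eq_of_ne ha]) n z
  rw [pointAug_fst, pointAug_snd] at hmin
  have hπ0 : 0 ≤ tensorFun μ z := (tensorFun_pos hμ z).le
  unfold kernelAt
  calc (1 - (2 * (K : ℝ) + p) / p * (1 - t * c * p / (2 * m)) ^ n) * tensorFun μ z
      ≤ lawAt Q (Pi.single (univ : Finset (Fin (K + 1))) 1) n ∅ * tensorFun μ z :=
        mul_le_mul_of_nonneg_right (by linarith) hπ0
    _ ≤ _ := hmin

/-- **`Pⁿ(x,z) ≥ (1 − ((2K+p)/p)·(1 − tcp/(2m))ⁿ)·π̃(z)` WITH A DOEBLIN-MINORISED HOT SAMPLER** (`M_0(u,·) ≥ a·μ_0`,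
`0 < a ≤ 1`, `μ_k`-stationary kernels, one-sided domination, `4t ≤ p(1−t)·a·w_0`). [ours] -/
theorem doeblinStar_kernelAt_ge (hm : 1 ≤ m) (ht0 : 0 ≤ t) (ht1 : t ≤ 1) (hw0 : ∀ k, 0 ≤ w k) (hw1 : ∑ k, w k = 1)
    (hμ : ∀ k x, 0 < μ k x) (hμ1 : ∀ k, ∑ u, μ k u = 1) (hM : ∀ k, IsRowStochastic (M k))
    (hstat : ∀ (k : Fin (K + 1)) (v : S), ∑ u, μ k u * M k u v = μ k v) (ha0 : 0 < a) (ha1 : a ≤ 1)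
    (hmin : ∀ u v, a * μ 0 v ≤ M 0 u v)
    (hp0 : 0 < p) (hp1 : p ≤ 1) (hdom : ∀ r u, p * μ (κ r).succ (φ r u) ≤ μ 0 u)
    (hreg : 4 * t ≤ p * (1 - t) * (a * w 0))
    {c : ℕ} (hc1 : 1 ≤ c) (hc : ∀ p' : Fin K, c ≤ (univ.filter (fun r : Fin m => κ r = p')).card) (hcm : c ≤ m)
    (n : ℕ) (x z : Fin (K + 1) → S) :
    (1 - (2 * (K : ℝ) + p) / p * (1 - t * c * p / (2 * m)) ^ n) * tensorFun μ z
      ≤ kernelAt (fun y z : Fin (K + 1) → S =>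
          t * ptGraphSwap μ (fun r : Fin m => (((0 : Fin (K + 1)), (κ r).succ) : Fin (K + 1) × Fin (K + 1))) φ y z
          + (1 - t) * prodKernel w M y z) n x z := by
  set R : S → S → ℝ := fun u v => if a < 1 then (M 0 u v - a * μ 0 v) / (1 - a) else μ 0 v with hR_def
  have hR : ∀ u v, R u v = if a < 1 then (M 0 u v - a * μ 0 v) / (1 - a) else μ 0 v := fun _ _ => rfl
  set E : Fin (K + 1) → S → S → ℝ := fun k _ v => μ k v with hE_def
  have hE : ∀ k u v, E k u v = μ k v := fun _ _ _ => rfl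
  set N : Fin (K + 1) → S → S → ℝ := fun k u v => if k = 0 then R u v else M k u v with hN_def
  have hN : ∀ k u v, N k u v = if k = 0 then R u v else M k u v := fun _ _ _ => rfl
  set w' : Fin (K + 1) → ℝ := fun k => if k = 0 then (1 - a) * w 0 else w k with hw'_def
  have hw' : ∀ k, w' k = if k = 0 then (1 - a) * w 0 else w k := fun _ => rfl
  obtain ⟨hsplit, hNrs, hNst⟩ := doeblin_residualFamily hM hμ hμ1 hstat ha1 hmin hR hN
  obtain ⟨hw'0, hw'1⟩ := doeblin_weights ha1 hw0 hw1 hw'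
  rw [doeblin_scheme_eq κ φ hsplit hE hN hw']
  exact refreshStar_kernelAt_ge κ φ hm ht0 ht1 (mul_nonneg ha0.le (hw0 0)) hw'0 hw'1 hμ hμ1 hNrs hE hNst hp0 hp1 hdom
    hreg hc1 hc hcm n x z

/-- **THE SEPARATION CEILING WITH A DOEBLIN-MINORISED HOT SAMPLER: `s(n) ≤ ((2K+p)/p)·(1 − tcp/(2m))ⁿ`** once
`4t ≤ p(1−t)·a·w_0`. [ours] -/
theorem doeblinStar_sepDist_le (hm : 1 ≤ m) (ht0 : 0 ≤ t) (ht1 : t ≤ 1) (hw0 : ∀ k, 0 ≤ w k) (hw1 : ∑ k, w k = 1)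
    (hμ : ∀ k x, 0 < μ k x) (hμ1 : ∀ k, ∑ u, μ k u = 1) (hM : ∀ k, IsRowStochastic (M k))
    (hstat : ∀ (k : Fin (K + 1)) (v : S), ∑ u, μ k u * M k u v = μ k v) (ha0 : 0 < a) (ha1 : a ≤ 1)
    (hmin : ∀ u v, a * μ 0 v ≤ M 0 u v)
    (hp0 : 0 < p) (hp1 : p ≤ 1) (hdom : ∀ r u, p * μ (κ r).succ (φ r u) ≤ μ 0 u)
    (hreg : 4 * t ≤ p * (1 - t) * (a * w 0))
    {c : ℕ} (hc1 : 1 ≤ c) (hc : ∀ p' : Fin K, c ≤ (univ.filter (fun r : Fin m => κ r = p')).card) (hcm : c ≤ m)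
    (n : ℕ) :
    sepDist (fun y z : Fin (K + 1) → S =>
          t * ptGraphSwap μ (fun r : Fin m => (((0 : Fin (K + 1)), (κ r).succ) : Fin (K + 1) × Fin (K + 1))) φ y z
          + (1 - t) * prodKernel w M y z) (tensorFun μ) n
      ≤ (2 * (K : ℝ) + p) / p * (1 - t * c * p / (2 * m)) ^ n := by
  have hbound : 0 ≤ (2 * (K : ℝ) + p) / p * (1 - t * c * p / (2 * m)) ^ n :=
    (worstTvDist_nonneg _ _ n).trans
      (doeblinStar_worstTvDist_le κ φ hm ht0 ht1 hw0 hw1 hμ hμ1 hM hstat ha0 ha1 hmin hp0 hp1 hdom hreg hc1 hc hcm n)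
  have h := sepDist_le_of_minorization (P := fun y z : Fin (K + 1) → S =>
      t * ptGraphSwap μ (fun r : Fin m => (((0 : Fin (K + 1)), (κ r).succ) : Fin (K + 1) × Fin (K + 1))) φ y z
        + (1 - t) * prodKernel w M y z) (fun z => tensorFun_pos hμ z) (a := 1 - (2 * (K : ℝ) + p) / p *
      (1 - t * c * p / (2 * m)) ^ n) (by linarith)
    (doeblinStar_kernelAt_ge κ φ hm ht0 ht1 hw0 hw1 hμ hμ1 hM hstat ha0 ha1 hmin hp0 hp1 hdom hreg hc1 hc hcm n)
  linarith

/-- **`s(n) ≤ ε` AFTER `(2m/(tcp))·log((2K+p)/(pε))` STEPS** with a Doeblin-minorised hot sampler (`0 < t`): the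
whole-space Doeblin condition `Pⁿ(x,·) ≥ (1−ε)·π̃`. [ours] -/
theorem doeblinStar_sepDist_le_of_ge_log (hm : 1 ≤ m) (ht0 : 0 < t) (ht1 : t ≤ 1) (hw0 : ∀ k, 0 ≤ w k)
    (hw1 : ∑ k, w k = 1) (hμ : ∀ k x, 0 < μ k x) (hμ1 : ∀ k, ∑ u, μ k u = 1) (hM : ∀ k, IsRowStochastic (M k))
    (hstat : ∀ (k : Fin (K + 1)) (v : S), ∑ u, μ k u * M k u v = μ k v) (ha0 : 0 < a) (ha1 : a ≤ 1)
    (hmin : ∀ u v, a * μ 0 v ≤ M 0 u v)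
    (hp0 : 0 < p) (hp1 : p ≤ 1) (hdom : ∀ r u, p * μ (κ r).succ (φ r u) ≤ μ 0 u)
    (hreg : 4 * t ≤ p * (1 - t) * (a * w 0))
    {c : ℕ} (hc1 : 1 ≤ c) (hc : ∀ p' : Fin K, c ≤ (univ.filter (fun r : Fin m => κ r = p')).card) (hcm : c ≤ m)
    {ε : ℝ} (hε : 0 < ε) {n : ℕ} (hn : 2 * (m : ℝ) / (t * c * p) * Real.log ((2 * (K : ℝ) + p) / (p * ε)) ≤ n) :
    sepDist (fun y z : Fin (K + 1) → S =>
          t * ptGraphSwap μ (fun r : Fin m => (((0 : Fin (K + 1)), (κ r).succ) : Fin (K + 1) × Fin (K + 1))) φ y z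
          + (1 - t) * prodKernel w M y z) (tensorFun μ) n ≤ ε := by
  have hmpos : (0 : ℝ) < m := Nat.cast_pos.mpr (by omega)
  have hcpos : (0 : ℝ) < c := Nat.cast_pos.mpr (by omega)
  have hcm' : (c : ℝ) ≤ m := by exact_mod_cast hcm
  refine (doeblinStar_sepDist_le κ φ hm ht0.le ht1 hw0 hw1 hμ hμ1 hM hstat ha0 ha1 hmin hp0 hp1 hdom hreg hc1 hc hcm
    n).trans ?_
  have hq0 : 0 < t * c * p / (2 * m) := by positivity
  have hq1 : t * c * p / (2 * m) ≤ 1 := by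
    rw [div_le_one (by positivity)]
    have h1 : t * c ≤ 1 * m := by nlinarith
    nlinarith
  have hC : 0 < (2 * (K : ℝ) + p) / p := by positivity
  refine geom_le_of_ge_log hq0 hq1 hC hε ?_
  have e1 : 1 / (t * c * p / (2 * m)) = 2 * (m : ℝ) / (t * c * p) := by field_simp
  have e2 : (2 * (K : ℝ) + p) / p / ε = (2 * (K : ℝ) + p) / (p * ε) := by rw [div_div]
  rw [e1, e2]; exact hn

/-! ## §2 Irreducibility and the integrated autocorrelation time of every observable -/

/-- **THE SCHEME WITH A DOEBLIN-MINORISED HOT SAMPLER IS IRREDUCIBLE** (reversible single-site kernels, `0 < t`,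
`4t ≤ p(1−t)·a·w_0`): some power of `P` is everywhere positive. [ours] -/
theorem doeblinStar_isIrreducible (hm : 1 ≤ m) (ht0 : 0 < t) (ht1 : t ≤ 1) (hw0 : ∀ k, 0 ≤ w k) (hw1 : ∑ k, w k = 1)
    (hμ : ∀ k x, 0 < μ k x) (hμ1 : ∀ k, ∑ u, μ k u = 1) (hM : ∀ k, IsRowStochastic (M k))
    (hMrev : ∀ k, DetailedBalance (μ k) (M k)) (ha0 : 0 < a) (ha1 : a ≤ 1) (hmin : ∀ u v, a * μ 0 v ≤ M 0 u v)
    (hp0 : 0 < p) (hp1 : p ≤ 1) (hdom : ∀ r u, p * μ (κ r).succ (φ r u) ≤ μ 0 u)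
    (hreg : 4 * t ≤ p * (1 - t) * (a * w 0))
    {c : ℕ} (hc1 : 1 ≤ c) (hc : ∀ p' : Fin K, c ≤ (univ.filter (fun r : Fin m => κ r = p')).card) (hcm : c ≤ m) :
    Literature.Probability.MarkovChains.IsIrreducible (fun y z : Fin (K + 1) → S =>
        t * ptGraphSwap μ (fun r : Fin m => (((0 : Fin (K + 1)), (κ r).succ) : Fin (K + 1) × Fin (K + 1))) φ y z
          + (1 - t) * prodKernel w M y z) := by
  have hstat : ∀ (k : Fin (K + 1)) (v : S), ∑ u, μ k u * M k u v = μ k v := fun k v => (hMrev k).isStationary (hM k).2 v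
  have hmpos : (0 : ℝ) < m := Nat.cast_pos.mpr (by omega)
  have hcpos : (0 : ℝ) < c := Nat.cast_pos.mpr (by omega)
  have hKp : 0 < 2 * (K : ℝ) + p := by positivity
  have hρ1 : 1 - t * c * p / (2 * m) < 1 := by
    have : 0 < t * c * p / (2 * m) := by positivity
    linarith
  obtain ⟨n, hn⟩ := exists_pow_lt_of_lt_one (div_pos hp0 hKp) hρ1
  have hlt : (2 * (K : ℝ) + p) / p * (1 - t * c * p / (2 * m)) ^ n < 1 := by
    have h1 := mul_lt_mul_of_pos_left hn (div_pos hKp hp0)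
    have e : (2 * (K : ℝ) + p) / p * (p / (2 * (K : ℝ) + p)) = 1 := by field_simp
    rwa [e] at h1
  refine isIrreducible_of_kernelAt_pos (n := n) fun x z => ?_
  have hge := doeblinStar_kernelAt_ge κ φ hm ht0.le ht1 hw0 hw1 hμ hμ1 hM hstat ha0 ha1 hmin hp0 hp1 hdom hreg hc1 hc
    hcm n x z
  exact lt_of_lt_of_le (mul_pos (by linarith) (tensorFun_pos hμ z)) hge

/-- **THE ASYMPTOTIC VARIANCE OF EVERY OBSERVABLE: `v(g) ≤ (2/(tcp/(2m)) − 1)·Var_π̃(g)`** with a Doeblin-minorised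
hot sampler (reversible single-site kernels, `|S| ≥ 2`, `0 < t`, `4t ≤ p(1−t)·a·w_0`). [ours] -/
theorem doeblinStar_asympVar_le [Nontrivial S] (hm : 1 ≤ m) (ht0 : 0 < t) (ht1 : t ≤ 1) (hw0 : ∀ k, 0 ≤ w k)
    (hw1 : ∑ k, w k = 1) (hμ : ∀ k x, 0 < μ k x) (hμ1 : ∀ k, ∑ u, μ k u = 1) (hM : ∀ k, IsRowStochastic (M k))
    (hMrev : ∀ k, DetailedBalance (μ k) (M k)) (ha0 : 0 < a) (ha1 : a ≤ 1) (hmin : ∀ u v, a * μ 0 v ≤ M 0 u v)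
    (hp0 : 0 < p) (hp1 : p ≤ 1) (hdom : ∀ r u, p * μ (κ r).succ (φ r u) ≤ μ 0 u)
    (hreg : 4 * t ≤ p * (1 - t) * (a * w 0))
    {c : ℕ} (hc1 : 1 ≤ c) (hc : ∀ p' : Fin K, c ≤ (univ.filter (fun r : Fin m => κ r = p')).card) (hcm : c ≤ m)
    (g : (Fin (K + 1) → S) → ℝ) :
    asympVar g (tensorFun μ) (fun y z : Fin (K + 1) → S =>
        t * ptGraphSwap μ (fun r : Fin m => (((0 : Fin (K + 1)), (κ r).succ) : Fin (K + 1) × Fin (K + 1))) φ y z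
          + (1 - t) * prodKernel w M y z)
      ≤ (2 / (t * c * p / (2 * m)) - 1) * lawVariance (tensorFun μ) g := by
  have hmpos : (0 : ℝ) < m := Nat.cast_pos.mpr (by omega)
  have hcpos : (0 : ℝ) < c := Nat.cast_pos.mpr (by omega)
  have hP := weightedScheme_isRowStochastic (t := t) (w := w)
    (ptGraphSwap_isRowStochastic (e := fun r : Fin m => (((0 : Fin (K + 1)), (κ r).succ) : Fin (K + 1) × Fin (K + 1)))
      (φ := φ) hμ) hM hw0 hw1 ht0.le ht1
  exact asympVar_le_of_absSpectralGap_ge (fun z => tensorFun_pos hμ z) (sum_tensorFun_eq_one _ hμ1) hP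
    (dominatedStar_detailedBalance κ φ hμ hMrev)
    (doeblinStar_isIrreducible κ φ hm ht0 ht1 hw0 hw1 hμ hμ1 hM hMrev ha0 ha1 hmin hp0 hp1 hdom hreg hc1 hc hcm)
    (by positivity)
    (doeblinStar_absSpectralGap_ge κ φ hm ht0.le ht1 hw0 hw1 hμ hμ1 hM hMrev ha0 ha1 hmin hp0 hp1 hdom hreg hc1 hc hcm) g

/-- **THE INTEGRATED AUTOCORRELATION TIME OF EVERY OBSERVABLE WITH A DOEBLIN-MINORISED HOT SAMPLER:
`τ_int(g) = v(g)/(2Var_π̃(g)) ≤ 1/(tcp/(2m)) − ½`** (`= 2m/(tcp) − ½`; reversible single-site kernels, `|S| ≥ 2`, `0 < t`,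
`4t ≤ p(1−t)·a·w_0`). [ours] -/
theorem doeblinStar_tauInt_le [Nontrivial S] (hm : 1 ≤ m) (ht0 : 0 < t) (ht1 : t ≤ 1) (hw0 : ∀ k, 0 ≤ w k)
    (hw1 : ∑ k, w k = 1) (hμ : ∀ k x, 0 < μ k x) (hμ1 : ∀ k, ∑ u, μ k u = 1) (hM : ∀ k, IsRowStochastic (M k))
    (hMrev : ∀ k, DetailedBalance (μ k) (M k)) (ha0 : 0 < a) (ha1 : a ≤ 1) (hmin : ∀ u v, a * μ 0 v ≤ M 0 u v)
    (hp0 : 0 < p) (hp1 : p ≤ 1) (hdom : ∀ r u, p * μ (κ r).succ (φ r u) ≤ μ 0 u)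
    (hreg : 4 * t ≤ p * (1 - t) * (a * w 0))
    {c : ℕ} (hc1 : 1 ≤ c) (hc : ∀ p' : Fin K, c ≤ (univ.filter (fun r : Fin m => κ r = p')).card) (hcm : c ≤ m)
    (g : (Fin (K + 1) → S) → ℝ) :
    asympVar g (tensorFun μ) (fun y z : Fin (K + 1) → S =>
        t * ptGraphSwap μ (fun r : Fin m => (((0 : Fin (K + 1)), (κ r).succ) : Fin (K + 1) × Fin (K + 1))) φ y z
          + (1 - t) * prodKernel w M y z) / (2 * lawVariance (tensorFun μ) g)
      ≤ 1 / (t * c * p / (2 * m)) - 1 / 2 := by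
  have hmpos : (0 : ℝ) < m := Nat.cast_pos.mpr (by omega)
  have hcpos : (0 : ℝ) < c := Nat.cast_pos.mpr (by omega)
  have hcm' : (c : ℝ) ≤ m := by exact_mod_cast hcm
  have hP := weightedScheme_isRowStochastic (t := t) (w := w)
    (ptGraphSwap_isRowStochastic (e := fun r : Fin m => (((0 : Fin (K + 1)), (κ r).succ) : Fin (K + 1) × Fin (K + 1)))
      (φ := φ) hμ) hM hw0 hw1 ht0.le ht1
  have hq1 : t * c * p / (2 * m) ≤ 1 := by
    rw [div_le_one (by positivity)]
    have h1 : t * c ≤ 1 * m := by nlinarith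
    nlinarith
  exact tauInt_le_of_absSpectralGap_ge (fun z => tensorFun_pos hμ z) (sum_tensorFun_eq_one _ hμ1) hP
    (dominatedStar_detailedBalance κ φ hμ hMrev)
    (doeblinStar_isIrreducible κ φ hm ht0 ht1 hw0 hw1 hμ hμ1 hM hMrev ha0 ha1 hmin hp0 hp1 hdom hreg hc1 hc hcm)
    (by positivity) hq1
    (doeblinStar_absSpectralGap_ge κ φ hm ht0.le ht1 hw0 hw1 hμ hμ1 hM hMrev ha0 ha1 hmin hp0 hp1 hdom hreg hc1 hc hcm) g

end Sep

end Summit.Ventures.LatticeQCDFlow.Scaling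

end
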